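import Mathlib
import HarnessLib
import Summits.QuantumAdvantage.QuantumAdvantage.Theorems.DigitDialL
import Summits.QuantumAdvantage.QuantumAdvantage.Theorems.DigitDialN

set_option linter.dupNamespace false
set_option autoImplicit false

/-!
# DigitDial (O) — THE LONG-MEMORY DIAL: strategies reading a BANDED quadratic form (ANY bandwidth) mod ANY `M` lose the u-walk game
# (cell decomp-qadv, lens 4, g20 rev 8)

Prop-definition-free tree twin of §11d–e of the lens-4 g20 node `DigitDial`.  The strategies: `y_g(u) = tab_g(B(u))`,
`B(u) = Σ_i [u_i]·(l_i + Σ_{d ≤ w} [u_{i-(w+1)+d}]·q_{i,d}) ∈ ℤ/M` (a quadratic form of BANDWIDTH `w+1` plus a linear form,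
ARBITRARY per-cut tables `tab_g : ℤ/M → Bool`).
* `char_bandChain_eq_prod`: `e_M(j·B(u))` is the product of the long-memory site phases of part N;
* `site_contractW`: at every site whose LONGEST-bond coefficient is `≠ 0` (mod `j`) the long-memory transfer contracts by
  `ρ_M = ((1+cos(π/M))/2)^{1/2} < 1` (part L's `rhoQ`), for EVERY modulus `M`;
* `corr_win_band_le`: `|Σ_u [WIN_Y(u)]·e_M(j·B(u))| ≤ 3·2^{w+1}·ρ_M^{#{i : j q_{i,0} ≠ 0}}·2ⁿ` for every oblivious firing set `Y`;
* `bStrat_card_win_le`: `#WIN ≤ (3/4 + 6M·2^w·ρ_M^s)·2ⁿ` (via part L's `card_win_tab_le_of`), `exists_band_threshold`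
  (`s ≥ s₁ + w·s₂` suffices), `bStrat_card_win_le_seven_eighths`, and at a PRIME modulus `bStrat_card_win_le_prime`
  (support `≥ (w+1)·log₂ n`, `n ≥ n₀(p)`); `qStrat_eq_bStrat`: memory `1` is part L's quad-chain class.
Supports the blocker `OddPrimeWalk:23109` (the X-form `∀ p ≥ 5, WalkHardF p`): the banded-quadratic sub-game is lost at rate `7/8`.
0 sorry; axioms standard; no `instance`, no `notation`, no `native_decide`; no `def … : Prop`.
-/

noncomputable section

namespace Summit.QuantumAdvantage.QuantumAdvantage.Theorems.DigitDial

open Finset Summit.QuantumAdvantage.AdviceFreeQNC0 Literature.Computability.MetaComplexity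
open TwistedTransfer ConstBells

/-! ### The strategy class: a BANDED quadratic form (bandwidth `w+1`) + linear form mod `M`, arbitrary tables -/

section BandChain

variable {n : ℕ} {M : ℕ} [NeZero M] {w : ℕ}

open TwistQ TwistW

/-- The banded quadratic form plus linear form read by the strategy:
`B(u) = Σ_i [u_i]·(l_i + Σ_{d ≤ w} [u_{i-(w+1)+d}]·q_{i,d})` (bits before position `0` are `0`; `q_{i,0}` multiplies the
LONGEST bond `(i-(w+1), i)`). -/
def bandChain (q : Fin n → Fin (w + 1) → ZMod M) (l : Fin n → ZMod M) (u : Fin n → Bool) : ZMod M :=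
  ∑ i : Fin n, if u i then (l i + ∑ d : Fin (w + 1), if memAt (fun _ => false) u i.val d then q i d else 0) else 0

/-- A BAND-CHAIN STRATEGY: cut `g` fires according to an arbitrary table `tab g : ℤ/M → Bool` read at `B(u)`. -/
def bStrat (q : Fin n → Fin (w + 1) → ZMod M) (l : Fin n → ZMod M) (tab : Fin (n + 1) → ZMod M → Bool) :
    Fin (n + 1) → (Fin n → Bool) → Bool :=
  fun g u => tab g (bandChain q l u)

/-- The memory-dependent site phases `ζ_i(b) = e_M(j·Σ_d [b_d] q_{i,d})` (and `1` beyond the input length). -/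
def zetaW (j : ZMod M) (q : Fin n → Fin (w + 1) → ZMod M) (i : ℕ) (b : Fin (w + 1) → Bool) : ℂ :=
  if h : i < n then (ZMod.stdAddChar (j * ∑ d : Fin (w + 1), if b d then q ⟨i, h⟩ d else 0) : ℂ) else 1

/-- The character of the banded form is the product of the long-memory site phases. -/
theorem char_bandChain_eq_prod (j : ZMod M) (q : Fin n → Fin (w + 1) → ZMod M) (l : Fin n → ZMod M) (u : Fin n → Bool) :
    (ZMod.stdAddChar (j * bandChain q l u) : ℂ) =
      ∏ i : Fin n, qphW (zetaW j q i.val) (zetaQ j l i.val) (u i) (memAt (fun _ => false) u i.val) := by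
  unfold bandChain
  rw [Finset.mul_sum]
  have hre : (∑ i : Fin n, j * (if u i then
      (l i + ∑ d : Fin (w + 1), if memAt (fun _ => false) u i.val d then q i d else 0) else 0)) =
      ∑ i : Fin n, (if u i then
        j * (l i + ∑ d : Fin (w + 1), if memAt (fun _ => false) u i.val d then q i d else 0) else 0) := by
    refine Finset.sum_congr rfl fun i _ => ?_
    split_ifs <;> simp
  rw [hre, TwoModuli.stdAddChar_sum_ite]
  refine Finset.prod_congr rfl fun i _ => ?_
  unfold qphW zetaW zetaQ
  rw [dif_pos i.isLt, dif_pos i.isLt]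
  by_cases hu : u i = true
  · rw [if_pos hu, if_pos hu, mul_add, AddChar.map_add_eq_mul, mul_comm]
  · rw [if_neg hu, if_neg hu]

/-- The per-site contraction factors: `ρ_M` where the LONGEST-bond coefficient is non-zero (mod `j`). -/
def siteRhoW (j : ZMod M) (q : Fin n → Fin (w + 1) → ZMod M) (i : ℕ) : ℝ :=
  if h : i < n then (if j * q ⟨i, h⟩ 0 = 0 then 1 else rhoQ M) else 1

/-- The phases of two memories differing in the oldest bit differ by the factor of the longest bond. -/
theorem zetaW_cons (j : ZMod M) (q : Fin n → Fin (w + 1) → ZMod M) {i : ℕ} (hi : i < n) (c : Bool) (b' : Fin w → Bool) :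
    zetaW j q i (Fin.cons c b') =
      (ZMod.stdAddChar (j * ∑ d : Fin w, if b' d then q ⟨i, hi⟩ d.succ else 0) : ℂ) *
        (if c then (ZMod.stdAddChar (j * q ⟨i, hi⟩ 0) : ℂ) else 1) := by
  unfold zetaW
  rw [dif_pos hi, Fin.sum_univ_succ]
  simp only [Fin.cons_zero, Fin.cons_succ]
  cases c
  · simp
  · simp only [if_true, mul_add, AddChar.map_add_eq_mul]
    ring

/-- **Every site contracts by its factor.** -/
theorem site_contractW (j : ZMod M) (q : Fin n → Fin (w + 1) → ZMod M) (l : Fin n → ZMod M) (g : ℕ)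
    (v : ZMod 3 → (Fin (w + 1) → Bool) → ℂ) :
    cnsqW (twAvgW (zetaW j q g) (zetaQ j l g) v) ≤ siteRhoW j q g ^ 2 * cnsqW v := by
  have hnorm1 : ∀ a : ZMod M, ‖(ZMod.stdAddChar a : ℂ)‖ ≤ 1 := fun a => by
    rw [ZMod.stdAddChar_apply, Circle.norm_coe]
  have hnorm1' : ∀ a : ZMod M, ‖(ZMod.stdAddChar a : ℂ)‖ = 1 := fun a => by
    rw [ZMod.stdAddChar_apply, Circle.norm_coe]
  have hζ : ∀ b, ‖zetaW j q g b‖ ≤ 1 := by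
    intro b; unfold zetaW; split_ifs
    · exact hnorm1 _
    · simp
  have hη : ‖zetaQ j l g‖ ≤ 1 := by
    unfold zetaQ; split_ifs
    · exact hnorm1 _
    · simp
  unfold siteRhoW
  by_cases hg : g < n
  · rw [dif_pos hg]
    have hpair : ∀ b' : Fin w → Bool, ‖zetaW j q g (Fin.cons false b') + zetaW j q g (Fin.cons true b')‖ =
        ‖(1 : ℂ) + ZMod.stdAddChar (j * q ⟨g, hg⟩ 0)‖ := by
      intro b'
      rw [zetaW_cons j q hg, zetaW_cons j q hg]
      simp only [if_true, Bool.false_eq_true, if_false]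
      rw [← mul_add, norm_mul, hnorm1', one_mul]
    by_cases h0 : j * q ⟨g, hg⟩ 0 = 0
    · rw [if_pos h0]
      have hl : ∀ b' : Fin w → Bool, ‖zetaW j q g (Fin.cons false b') + zetaW j q g (Fin.cons true b')‖ ≤ 2 * 1 := by
        intro b'
        rw [hpair]
        calc ‖(1 : ℂ) + ZMod.stdAddChar (j * q ⟨g, hg⟩ 0)‖ ≤ ‖(1 : ℂ)‖ + ‖(ZMod.stdAddChar (j * q ⟨g, hg⟩ 0) : ℂ)‖ :=
              norm_add_le _ _
          _ ≤ 2 * 1 := by rw [norm_one, hnorm1']; norm_num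
      have := cnsqW_twAvgW_le hη hζ hl v
      linarith
    · rw [if_neg h0, rhoQ_sq]
      have hl : ∀ b' : Fin w → Bool, ‖zetaW j q g (Fin.cons false b') + zetaW j q g (Fin.cons true b')‖ ≤
          2 * Real.cos (Real.pi / M) := by
        intro b'; rw [hpair]; exact TwoModuli.norm_one_add_stdAddChar_le h0
      exact cnsqW_twAvgW_le hη hζ hl v
  · rw [dif_neg hg]
    have hl : ∀ b' : Fin w → Bool, ‖zetaW j q g (Fin.cons false b') + zetaW j q g (Fin.cons true b')‖ ≤ 2 * 1 := by
      intro b'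
      calc ‖zetaW j q g (Fin.cons false b') + zetaW j q g (Fin.cons true b')‖
          ≤ ‖zetaW j q g (Fin.cons false b')‖ + ‖zetaW j q g (Fin.cons true b')‖ := norm_add_le _ _
        _ ≤ 2 * 1 := by have := hζ (Fin.cons false b'); have := hζ (Fin.cons true b'); linarith
    have := cnsqW_twAvgW_le hη hζ hl v
    linarith

omit [NeZero M] in
/-- `Π_{i<n} siteRhoW² = (ρ_M²)^{#{i : j q_{i,0} ≠ 0}}`. -/
theorem prod_siteRhoW_sq [NeZero M] (j : ZMod M) (q : Fin n → Fin (w + 1) → ZMod M) :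
    (∏ i ∈ range n, siteRhoW j q (0 + i) ^ 2) =
      (rhoQ M ^ 2) ^ (univ.filter fun i : Fin n => j * q i 0 ≠ 0).card := by
  classical
  simp only [zero_add]
  rw [← Fin.prod_univ_eq_prod_range (fun i => siteRhoW j q i ^ 2) n]
  have h : ∀ i : Fin n, siteRhoW j q i.val ^ 2 = if j * q i 0 ≠ 0 then rhoQ M ^ 2 else 1 := by
    intro i
    unfold siteRhoW
    rw [dif_pos i.isLt]
    by_cases hb : j * q i 0 = 0
    · rw [if_pos hb, if_neg (not_not.2 hb), one_pow]
    · rw [if_neg hb, if_pos hb]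
  rw [Finset.prod_congr rfl (fun i _ => h i), Finset.prod_ite, Finset.prod_const, Finset.prod_const_one, mul_one]

/-- The twisted sum `Σ_u sgnU(u)·e_M(j B(u))` of a constant strategy in long-memory transfer form. -/
theorem sum_sgnU_bchar (c : ℕ) (B : Finset (Fin (n + 1))) (j : ZMod M) (q : Fin n → Fin (w + 1) → ZMod M)
    (l : Fin n → ZMod M) :
    (∑ u : Fin n → Bool, (sgnU c B u : ℂ) *
        ∏ i : Fin n, qphW (zetaW j q i.val) (zetaQ j l i.val) (u i) (memAt (fun _ => false) u i.val)) =
      ∑ τ : ZMod 3, (2 : ℂ) ^ n *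
        TBVW (zetaW j q) (zetaQ j l) (fT (bellsN B) n (((c + 2 * n : ℕ) : ZMod 3)) τ) 0 n 0 (fun _ => false) := by
  have h : ∀ u : Fin n → Bool, (sgnU c B u : ℂ) *
      ∏ i : Fin n, qphW (zetaW j q i.val) (zetaQ j l i.val) (u i) (memAt (fun _ => false) u i.val) =
      ∑ τ : ZMod 3, ((∏ j' ∈ range (n + 1), fT (bellsN B) n (((c + 2 * n : ℕ) : ZMod 3)) τ (0 + j')
        (0 + ((j' + wtPrefix u j' : ℕ) : ZMod 3)) : ℝ) : ℂ) *
        ∏ i : Fin n, qphW (zetaW j q (0 + i.val)) (zetaQ j l (0 + i.val)) (u i) (memAt (fun _ => false) u i.val) := by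
    intro u
    rw [sgnU_eq_sum, Complex.ofReal_sum, Finset.sum_mul]
    simp only [zero_add]
    rfl
  simp_rw [h]
  rw [Finset.sum_comm]
  refine Finset.sum_congr rfl fun τ _ => ?_
  exact pathSumW_eq (zetaW j q) (zetaQ j l) _ n 0 0 (fun _ => false)

/-- The bound on one long-memory transfer vector: `|TBVW_0(0, 0⃗)| ≤ 2^{w+1}·ρ_M^{#{i : j q_{i,0} ≠ 0}}`. -/
theorem norm_TBVW_le (j : ZMod M) (q : Fin n → Fin (w + 1) → ZMod M) (l : Fin n → ZMod M) (BN : Finset ℕ) (κ τ : ZMod 3) :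
    ‖TBVW (zetaW j q) (zetaQ j l) (fT BN n κ τ) 0 n 0 (fun _ => false)‖ ≤
      (2 : ℝ) ^ (w + 1) * rhoQ M ^ (univ.filter fun i : Fin n => j * q i 0 ≠ 0).card := by
  set s := (univ.filter fun i : Fin n => j * q i 0 ≠ 0).card
  have h1 := cnsqW_TBVW_le (zetaW j q) (zetaQ j l) (fT BN n κ τ) (fT_sq_le BN n κ τ) (siteRhoW j q)
    (fun g v => site_contractW j q l g v) n 0
  rw [prod_siteRhoW_sq, zero_add] at h1
  have h2 : cnsqW (TBVW (zetaW j q) (zetaQ j l) (fT BN n κ τ) 0 n) ≤ (rhoQ M ^ 2) ^ s * (2 : ℝ) ^ (w + 1) := by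
    refine h1.trans ?_
    exact mul_le_mul_of_nonneg_left (cnsqW_TBVW_zero_le _ _ BN n κ τ) (by positivity)
  have h22 : (2 : ℝ) ^ (w + 1) ≤ ((2 : ℝ) ^ (w + 1)) ^ 2 := by
    have : (1 : ℝ) ≤ (2 : ℝ) ^ (w + 1) := one_le_pow₀ (by norm_num)
    nlinarith
  have h3 : ‖TBVW (zetaW j q) (zetaQ j l) (fT BN n κ τ) 0 n 0 (fun _ => false)‖ ^ 2 ≤
      ((2 : ℝ) ^ (w + 1) * rhoQ M ^ s) ^ 2 := by
    have h4 := (normSq_le_cnsqW _ 0 (fun _ => false)).trans h2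
    have h5 : (rhoQ M ^ 2) ^ s = (rhoQ M ^ s) ^ 2 := by rw [← pow_mul, mul_comm, pow_mul]
    rw [h5] at h4
    have h6 : (rhoQ M ^ s) ^ 2 * (2 : ℝ) ^ (w + 1) ≤ (rhoQ M ^ s) ^ 2 * ((2 : ℝ) ^ (w + 1)) ^ 2 :=
      mul_le_mul_of_nonneg_left h22 (sq_nonneg _)
    nlinarith [sq_nonneg (rhoQ M ^ s)]
  have hρ0 := rhoQ_nonneg M
  have h4 := abs_le_of_sq_le_sq h3 (by positivity)
  rwa [abs_norm] at h4

/-- The twisted sum of a constant strategy is small: `|Σ_u sgnU(u) e_M(j B(u))| ≤ 3·2^{w+1}·ρ_M^{s}·2ⁿ`. -/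
theorem norm_sum_sgnU_bchar_le (c : ℕ) (B : Finset (Fin (n + 1))) (j : ZMod M) (q : Fin n → Fin (w + 1) → ZMod M)
    (l : Fin n → ZMod M) :
    ‖∑ u : Fin n → Bool, (sgnU c B u : ℂ) *
        ∏ i : Fin n, qphW (zetaW j q i.val) (zetaQ j l i.val) (u i) (memAt (fun _ => false) u i.val)‖ ≤
      3 * (2 : ℝ) ^ (w + 1) * rhoQ M ^ (univ.filter fun i : Fin n => j * q i 0 ≠ 0).card * (2 : ℝ) ^ n := by
  rw [sum_sgnU_bchar]
  set s := (univ.filter fun i : Fin n => j * q i 0 ≠ 0).card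
  set κ : ZMod 3 := ((c + 2 * n : ℕ) : ZMod 3)
  have hτ : ∀ τ : ZMod 3, ‖(2 : ℂ) ^ n * TBVW (zetaW j q) (zetaQ j l) (fT (bellsN B) n κ τ) 0 n 0 (fun _ => false)‖ ≤
      (2 : ℝ) ^ n * ((2 : ℝ) ^ (w + 1) * rhoQ M ^ s) := by
    intro τ
    rw [norm_mul, norm_pow, Complex.norm_ofNat]
    exact mul_le_mul_of_nonneg_left (norm_TBVW_le j q l _ κ τ) (by positivity)
  have h3 : (∑ τ : ZMod 3, ‖(2 : ℂ) ^ n * TBVW (zetaW j q) (zetaQ j l) (fT (bellsN B) n κ τ) 0 n 0 (fun _ => false)‖) =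
      ‖(2 : ℂ) ^ n * TBVW (zetaW j q) (zetaQ j l) (fT (bellsN B) n κ 0) 0 n 0 (fun _ => false)‖ +
      ‖(2 : ℂ) ^ n * TBVW (zetaW j q) (zetaQ j l) (fT (bellsN B) n κ 1) 0 n 0 (fun _ => false)‖ +
      ‖(2 : ℂ) ^ n * TBVW (zetaW j q) (zetaQ j l) (fT (bellsN B) n κ 2) 0 n 0 (fun _ => false)‖ :=
    Fin.sum_univ_three _
  refine (norm_sum_le _ _).trans ?_
  rw [h3]
  have t0 := hτ 0; have t1 := hτ 1; have t2 := hτ 2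
  linarith

/-- **Correlation bound of the long-memory dial**: for every oblivious firing set `Y`, charge `c`, `j ∈ ℤ/M` and coefficients
`q, l`, `|Σ_u [WIN_Y(u)]·e_M(j·B(u))| ≤ 3·2^{w+1}·ρ_M^{#{i : j q_{i,0} ≠ 0}}·2ⁿ` — for EVERY modulus `M`. -/
theorem corr_win_band_le (c : ℕ) (Y : Finset (Fin (n + 1))) (j : ZMod M) (q : Fin n → Fin (w + 1) → ZMod M)
    (l : Fin n → ZMod M) :
    ‖∑ u : Fin n → Bool, (if ringWinU c (fun g _ => decide (g ∈ Y)) u = true then (1 : ℂ) else 0) *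
        (ZMod.stdAddChar (j * bandChain q l u) : ℂ)‖ ≤
      3 * (2 : ℝ) ^ (w + 1) * rhoQ M ^ (univ.filter fun i : Fin n => j * q i 0 ≠ 0).card * (2 : ℝ) ^ n := by
  set s := (univ.filter fun i : Fin n => j * q i 0 ≠ 0).card with hs
  set P : (Fin n → Bool) → ℂ := fun u =>
    ∏ i : Fin n, qphW (zetaW j q i.val) (zetaQ j l i.val) (u i) (memAt (fun _ => false) u i.val)
  have hterm : ∀ u : Fin n → Bool, (if ringWinU c (fun g _ => decide (g ∈ Y)) u = true then (1 : ℂ) else 0) *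
      (ZMod.stdAddChar (j * bandChain q l u) : ℂ) =
      (1 / 2) * ((sgnU c (∅ : Finset (Fin (n + 1))) u : ℂ) * P u) - (1 / 2) * ((sgnU c Y u : ℂ) * P u) := by
    intro u
    rw [win_indicator_eq, char_bandChain_eq_prod, sgnU_empty]
    push_cast; ring
  simp_rw [hterm]
  rw [Finset.sum_sub_distrib, ← Finset.mul_sum, ← Finset.mul_sum]
  have hA := norm_sum_sgnU_bchar_le c (∅ : Finset (Fin (n + 1))) j q l
  have hB := norm_sum_sgnU_bchar_le c Y j q l
  calc ‖(1 / 2 : ℂ) * (∑ u : Fin n → Bool, (sgnU c (∅ : Finset (Fin (n + 1))) u : ℂ) * P u) -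
        (1 / 2 : ℂ) * (∑ u : Fin n → Bool, (sgnU c Y u : ℂ) * P u)‖
      ≤ ‖(1 / 2 : ℂ) * (∑ u : Fin n → Bool, (sgnU c (∅ : Finset (Fin (n + 1))) u : ℂ) * P u)‖ +
        ‖(1 / 2 : ℂ) * (∑ u : Fin n → Bool, (sgnU c Y u : ℂ) * P u)‖ := norm_sub_le _ _
    _ ≤ 1 / 2 * (3 * (2 : ℝ) ^ (w + 1) * rhoQ M ^ s * (2 : ℝ) ^ n) +
        1 / 2 * (3 * (2 : ℝ) ^ (w + 1) * rhoQ M ^ s * (2 : ℝ) ^ n) := by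
        rw [norm_mul, norm_mul, show ‖(1 / 2 : ℂ)‖ = 1 / 2 from by norm_num]
        gcongr
    _ = 3 * (2 : ℝ) ^ (w + 1) * rhoQ M ^ s * (2 : ℝ) ^ n := by ring

/-! ### 11e. THE LONG-MEMORY DIAL: band-chain strategies lose, for EVERY modulus and EVERY bandwidth -/

/-- **MAIN THEOREM (finite, field-free, every modulus, every bandwidth).**  For every `M ≥ 1`, `n ≥ 4`, every charge, every
coefficients `q ∈ (ℤ/M)^{n×(w+1)}`, `l ∈ (ℤ/M)ⁿ`, every tables, and every `s` such that each non-zero multiple `j·q_{·,0}` of the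
LONGEST-bond coefficient vector has at least `s` non-zero coordinates:
`#WIN(bStrat q l tab) ≤ (3/4 + 6M·2^w·ρ_M^s)·2ⁿ`. -/
theorem bStrat_card_win_le (hn : 4 ≤ n) (c : ℕ) (q : Fin n → Fin (w + 1) → ZMod M) (l : Fin n → ZMod M)
    (tab : Fin (n + 1) → ZMod M → Bool) {s : ℕ}
    (hs : ∀ j : ZMod M, j ≠ 0 → s ≤ (univ.filter fun i : Fin n => j * q i 0 ≠ 0).card) :
    ((univ.filter fun u : Fin n → Bool => ringWinU c (bStrat q l tab) u = true).card : ℝ) ≤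
      (3 / 4 + 6 * M * (2 : ℝ) ^ w * rhoQ M ^ s) * (2 : ℝ) ^ n := by
  have hρ0 := rhoQ_nonneg M
  have hρ1 := (rhoQ_lt_one M).le
  have h := card_win_tab_le_of (M := M) c (θ₀ := 3 / 4) (E := 3 * (2 : ℝ) ^ (w + 1) * rhoQ M ^ s) (fun Y => ?_)
    (by positivity) (bandChain q l) (fun Y j hj => ?_) tab
  · calc ((univ.filter fun u : Fin n → Bool => ringWinU c (bStrat q l tab) u = true).card : ℝ)
        = ((univ.filter fun u : Fin n → Bool => ringWinU c (fun g u => tab g (bandChain q l u)) u = true).card : ℝ) := rfl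
      _ ≤ (3 / 4 + M * (3 * (2 : ℝ) ^ (w + 1) * rhoQ M ^ s)) * (2 : ℝ) ^ n := h
      _ = (3 / 4 + 6 * M * (2 : ℝ) ^ w * rhoQ M ^ s) * (2 : ℝ) ^ n := by rw [pow_succ]; ring
  · exact hiddenCoinsFour n c (∅ : Finset (Fin n)) (by simp; omega) (fun g _ => decide (g ∈ Y)) (fun _ _ _ _ => rfl)
  · refine (corr_win_band_le c Y j q l).trans ?_
    have hpow : rhoQ M ^ (univ.filter fun i : Fin n => j * q i 0 ≠ 0).card ≤ rhoQ M ^ s :=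
      pow_le_pow_of_le_one hρ0 hρ1 (hs j hj)
    have h2n : (0 : ℝ) ≤ (2 : ℝ) ^ n := by positivity
    have h2w : (0 : ℝ) ≤ 3 * (2 : ℝ) ^ (w + 1) := by positivity
    nlinarith [mul_le_mul_of_nonneg_left hpow h2w]

/-- The number of contracting sites needed, linear in the memory length: `6M·2^w·ρ_M^s ≤ 1/8` whenever `s ≥ s₁ + w·s₂`. -/
theorem exists_band_threshold (M : ℕ) [NeZero M] :
    ∃ s₁ s₂ : ℕ, ∀ w s : ℕ, s₁ + w * s₂ ≤ s → 6 * (M : ℝ) * (2 : ℝ) ^ w * rhoQ M ^ s ≤ 1 / 8 := by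
  obtain ⟨s₁, hs₁⟩ := exists_quad_threshold M
  obtain ⟨s₂, hs₂⟩ := exists_pow_lt_of_lt_one (show (0 : ℝ) < 1 / 2 by norm_num) (rhoQ_lt_one M)
  have hρ0 := rhoQ_nonneg M
  have hρ1 := (rhoQ_lt_one M).le
  have hMpos : (0 : ℝ) < M := by exact_mod_cast Nat.pos_of_ne_zero (NeZero.ne M)
  refine ⟨s₁, s₂, fun w s hs => ?_⟩
  have h1 : rhoQ M ^ s ≤ rhoQ M ^ (s₁ + w * s₂) := pow_le_pow_of_le_one hρ0 hρ1 hs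
  have h2 : rhoQ M ^ (s₁ + w * s₂) = rhoQ M ^ s₁ * (rhoQ M ^ s₂) ^ w := by rw [pow_add, mul_comm w, pow_mul]
  have h3 : (rhoQ M ^ s₂) ^ w ≤ (1 / 2 : ℝ) ^ w := pow_le_pow_left₀ (by positivity) hs₂.le w
  have h4 : (2 : ℝ) ^ w * (1 / 2 : ℝ) ^ w = 1 := by rw [← mul_pow]; norm_num
  have h5 : 6 * (M : ℝ) * rhoQ M ^ s₁ ≤ 1 / 8 := hs₁ s₁ le_rfl
  calc 6 * (M : ℝ) * (2 : ℝ) ^ w * rhoQ M ^ s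
      ≤ 6 * (M : ℝ) * (2 : ℝ) ^ w * (rhoQ M ^ s₁ * (rhoQ M ^ s₂) ^ w) := by
        rw [← h2]; exact mul_le_mul_of_nonneg_left h1 (by positivity)
    _ ≤ 6 * (M : ℝ) * (2 : ℝ) ^ w * (rhoQ M ^ s₁ * (1 / 2 : ℝ) ^ w) := by
        gcongr
    _ = 6 * (M : ℝ) * rhoQ M ^ s₁ * ((2 : ℝ) ^ w * (1 / 2 : ℝ) ^ w) := by ring
    _ ≤ 1 / 8 := by rw [h4, mul_one]; exact h5

/-- **THE LONG-MEMORY DIAL (asymptotic, every modulus, every bandwidth; Prop-definition-free form of the node's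
`BandChainHard`)**: for every `M ≥ 1` there are `s₁, s₂` such that every band-chain strategy mod `M` of memory `w+1` whose
longest-bond coefficient vector keeps `≥ s₁ + w·s₂` non-zero coordinates under every non-zero scaling wins the u-walk game on
`≤ (7/8)·2ⁿ` inputs (`n ≥ 4`, every charge, every tables). -/
theorem bStrat_card_win_le_seven_eighths (M : ℕ) [NeZero M] :
    ∃ s₁ s₂ : ℕ, ∀ (w n c : ℕ) (q : Fin n → Fin (w + 1) → ZMod M) (l : Fin n → ZMod M)
      (tab : Fin (n + 1) → ZMod M → Bool), 4 ≤ n →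
      (∀ j : ZMod M, j ≠ 0 → s₁ + w * s₂ ≤ (univ.filter fun i : Fin n => j * q i 0 ≠ 0).card) →
        ((univ.filter fun u : Fin n → Bool => ringWinU c (bStrat q l tab) u = true).card : ℝ) ≤ (7 / 8) * (2 : ℝ) ^ n := by
  obtain ⟨s₁, s₂, hs⟩ := exists_band_threshold M
  refine ⟨s₁, s₂, fun w n c q l tab hn hsq => ?_⟩
  have h := bStrat_card_win_le hn c q l tab hsq
  have h2n : (0 : ℝ) ≤ (2 : ℝ) ^ n := by positivity
  have := hs w (s₁ + w * s₂) le_rfl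
  nlinarith

omit [NeZero M] in
/-- Memory `1` is the quad-chain class: `qStrat q l tab = bStrat (w := 0) (fun i _ => q i) l tab`. -/
theorem qStrat_eq_bStrat (q l : Fin n → ZMod M) (tab : Fin (n + 1) → ZMod M → Bool) :
    qStrat q l tab = bStrat (fun i (_ : Fin (0 + 1)) => q i) l tab := by
  funext g u
  unfold qStrat bStrat quadChain bandChain
  congr 1
  refine Finset.sum_congr rfl fun i _ => ?_
  have hm : memAt (fun _ : Fin (0 + 1) => false) u i.val 0 = prevN false u i.val := by
    unfold memAt prevN
    simp only [Fin.val_zero, add_zero]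
    by_cases hi : i.val = 0
    · rw [dif_pos (by omega), if_pos hi]
    · rw [dif_neg (by omega), if_neg hi]
  rw [Fin.sum_univ_succ, Fin.sum_univ_zero, add_zero, hm]

/-- **At a PRIME modulus** (Prop-definition-free content of the node's rung `TBand`): every band-chain strategy mod `p` of
memory `w+1` whose longest-bond coefficient vector has `≥ (w+1)·log₂ n` non-zero entries wins on `≤ (7/8)·2ⁿ` inputs once
`n ≥ n₀(p)` — every bandwidth, every charge, every tables, no degree hypothesis. -/
theorem bStrat_card_win_le_prime (p : ℕ) [hp : Fact p.Prime] :
    ∃ n₀ : ℕ, ∀ (w n c : ℕ) (q : Fin n → Fin (w + 1) → ZMod p) (l : Fin n → ZMod p)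
      (tab : Fin (n + 1) → ZMod p → Bool), n₀ ≤ n →
      (w + 1) * Nat.log 2 n ≤ (univ.filter fun i : Fin n => q i 0 ≠ 0).card →
        ((univ.filter fun u : Fin n → Bool => ringWinU c (bStrat q l tab) u = true).card : ℝ) ≤ (7 / 8) * (2 : ℝ) ^ n := by
  haveI : NeZero p := ⟨hp.out.ne_zero⟩
  obtain ⟨s₁, s₂, hs⟩ := bStrat_card_win_le_seven_eighths p
  refine ⟨max (2 ^ (s₁ + s₂)) 4, fun w n c q l tab hn hq => ?_⟩
  have hn4 : 4 ≤ n := le_trans (le_max_right _ _) hn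
  have hlog : s₁ + s₂ ≤ Nat.log 2 n := Nat.le_log_of_pow_le (by norm_num) (le_trans (le_max_left _ _) hn)
  refine hs w n c q l tab hn4 (fun j hj => ?_)
  have hset : (univ.filter fun i : Fin n => j * q i 0 ≠ 0) = univ.filter fun i : Fin n => q i 0 ≠ 0 := by
    refine Finset.filter_congr fun i _ => ?_
    rw [mul_ne_zero_iff]
    exact ⟨fun h => h.2, fun h => ⟨hj, h⟩⟩
  rw [hset]
  have h1 : w * s₂ ≤ w * Nat.log 2 n := Nat.mul_le_mul_left w (by omega)
  have h2 : (w + 1) * Nat.log 2 n = w * Nat.log 2 n + Nat.log 2 n := by ring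
  omega

end BandChain

end Summit.QuantumAdvantage.QuantumAdvantage.Theorems.DigitDial
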